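import Literature.AlgebraicGeometry.Resolution.InseparableLocalUniformizationHeightStepFrontier
import Literature.AlgebraicGeometry.Resolution.GeneralizedStabilityHolds
import HarnessLib

/-!
# Temkin 2013, Thm. 5.5.2 (i) (`n = 1`): the discharge `Temkin2013Abhyankar_holds`

Topic: `Literature/AlgebraicGeometry/Resolution`. M. Temkin, *Inseparable local uniformization*,
J. Algebra 373 (2013) 65–119 = arXiv:0804.1554v3, **Thm. 5.5.2 (i)** (p. 60; Thm. 5.2.5 on p. 36
of the 41-pp. arXiv v1 held in the literature store): local uniformization of Abhyankar
valuations — for a finitely generated extension `K/k` with `char k = p > 0`, an Abhyankar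
`k`-valuation ring `𝒪` of `K` (`E_𝒪 + F_𝒪 = tr.deg_k K`) and an affine `k`-model of `𝒪`, there
are a finite purely inseparable `l/k`, an affine `l`-model `X'` of the extended valuation ring of
`L = lK` refining the normalized base change of `X`, such that `X'` is `l`-smooth at the centre
`x'` and `k(x')` is formally smooth over `l` — vendored as the named fact `Temkin2013Abhyankar`
(`InseparableLocalUniformizationAbhyankar.lean`).

The tree proves `Temkin2013Abhyankar.of_stability : Kuhlmann2010Stability → Temkin2013Abhyankar`
(`InseparableLocalUniformizationHeightStepFrontier.lean`): §5 of the source — Thm. 5.5.3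
(`Temkin2013_Thm553.of_stability`, `AbhyankarResidueSeparability.lean`) and Thm. 5.5.1 (iii)
(`Temkin2013_Thm551iii.of_inertial` with `Temkin2013_Thm551iii_inertial.of_stability`,
`ToricChartNormal.lean`, `AbhyankarToroidalChartsInertial.lean`) from the generalized stability
theorem (Remark 2.1.3 of the source), assembled with Prop. 5.4.3, Cor. 5.4.2 and Thm. A.2.1
(`Temkin2013Abhyankar.of_section5`, `InseparableLocalUniformizationAbhyankarProofs.lean`).
`GeneralizedStabilityHolds.lean` discharges Kuhlmann's generalized stability theorem over a
trivially valued ground field (`Kuhlmann2010Stability_holds`: F.-V. Kuhlmann, Trans. AMS 362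
(2010), Thm. 1.1). This file composes the two: the fact is now a theorem of the tree.

## Content (PROVED; no definitions, no new named facts)

* `Temkin2013Abhyankar_holds` — **DISCHARGE** of `Temkin2013Abhyankar`.

## Sources

* M. Temkin, *Inseparable local uniformization*, J. Algebra 373 (2013) 65–119
  = arXiv:0804.1554v3: Thm. 5.5.2 (i) (p. 60), proof pp. 60–61 (Thm. 5.5.1 (iii), Thm. 5.5.3,
  Prop. 5.4.3, Cor. 5.4.2, Thm. A.2.1), Remark 2.1.3 (p. 10). [Temkin2013]
* F.-V. Kuhlmann, *Elimination of ramification I: The generalized stability theorem*, Trans.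
  Amer. Math. Soc. 362 (2010) 5697–5727 = arXiv:1003.5678, Thm. 1.1. [Kuhlmann2010]
-/

namespace Literature.AlgebraicGeometry.Resolution

universe u

/-- **Temkin 2013, Thm. 5.5.2 (i) (`n = 1`, non-logarithmic), discharged**: local uniformization
of Abhyankar valuations in positive characteristic after a finite purely inseparable extension
of the ground field. The term is `Temkin2013Abhyankar.of_stability` (§5 of the source, proved in
the tree) applied to the discharge `Kuhlmann2010Stability_holds` of Kuhlmann's generalized
stability theorem (the one external input of §5, Remark 2.1.3). PROVED.
[cite: Temkin2013, Thm. 5.5.2 (i) (p. 60 of arXiv:0804.1554v3; = Thm. 5.2.5 of arXiv v1)]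
[cite: Kuhlmann2010, Thm. 1.1] -/
theorem Temkin2013Abhyankar_holds : Temkin2013Abhyankar.{u} :=
  Temkin2013Abhyankar.of_stability Kuhlmann2010Stability_holds

end Literature.AlgebraicGeometry.Resolution
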